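import Mathlib.Algebra.BigOperators.Ring.Finset
import Mathlib.Algebra.Order.BigOperators.Ring.Finset
import Mathlib.Data.Nat.Choose.Sum
import Mathlib.Data.Nat.Choose.Bounds
import Mathlib.Algebra.BigOperators.Associated
import Mathlib.Data.Nat.Factorization.Basic
import Mathlib.Analysis.Complex.Exponential
import HarnessLib

/-!
# Brun's pure sieve (Bonferroni truncation of inclusion–exclusion)

Trunk AntSieve, topic `Literature/NumberTheory/Sieve`.  A self-contained, fully proved form of
Brun's pure sieve in the elementary "Bonferroni" formulation, written for the decomposition of
`Literature.NumberTheory.Sieve.matomaki_radziwill` (Matomäki–Radziwiłł 2016, proof of Theorem 1, §9: "by the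
fundamental lemma of the sieve, `∑_{X ≤ n ≤ 2X, n ∉ 𝒮} 1 ≤ (1 + 1/100) X ∑_j ∏_{P_j ≤ p ≤ Q_j} (1 - 1/p)`";
for sifting ranges `Q_j ≤ exp(√log X)` the pure sieve already gives this).

## Content (all PROVED)

* `bonferroni_lower`, `bonferroni_upper` — the abstract Bonferroni inequalities: for nonnegative
  weights `w(T)` on the subsets `T ⊆ P` and `F(S) = ∑_{T ⊇ S} w(T)`, and `r` even,
  `w(∅) ≤ ∑_{k ≤ r} (-1)^k ∑_{#S = k} F(S) ≤ w(∅) + ∑_{#S = r+1} F(S)`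
  (the pointwise identity `∑_{k ≤ r} (-1)^k C(m, k) = (-1)^r C(m-1, r)`, Cojocaru–Murty (6.1)–(6.3)).
* `prod_one_sub_le_bonferroniSum`, `bonferroniSum_le_prod_one_sub_add` — the instance "independent
  events": for `0 ≤ ν(p) ≤ 1`,
  `∏_{p ∈ P} (1 - ν(p)) ≤ ∑_{k ≤ r} (-1)^k ∑_{#S = k} ∏_{p ∈ S} ν(p) ≤ ∏ (1 - ν(p)) + e_{r+1}(ν)`.
* `card_filter_forall_not_le_bonferroniSum` — the counting instance (Brun's pure sieve inequality,
  Cojocaru–Murty (6.5)), for a family of "events" `R p ·` indexed by `p ∈ P`: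
  `#{n ∈ A : ¬ R p n ∀ p ∈ P} ≤ ∑_{k ≤ r} (-1)^k ∑_{#S = k} #{n ∈ A : R p n ∀ p ∈ S}`.
* `esymm_le_inv_pow_mul_exp` — Rankin's bound `e_k(ν) ≤ λ^{-k} exp(λ ∑ ν(p))` (`λ > 0`);
  `sum_range_choose_le_pow` — `∑_{k ≤ r} C(m, k) ≤ (m+1)^r`;
  `abs_card_Icc_filter_dvd_sub_le` — `#{n ∈ [a, b] : d ∣ n} = (b + 1 - a)/d + θ`, `|θ| ≤ 1`.
* `brun_pure_sieve_Icc` — the pure sieve for an interval of integers sifted by a finite set of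
  primes `P`: for `1 ≤ a ≤ b + 1` and even `r`,
  `#{n ∈ [a, b] : p ∤ n ∀ p ∈ P} ≤ (b + 1 - a) (∏_{p ∈ P} (1 - 1/p) + e_{r+1}(1/p)) + ∑_{k ≤ r} C(#P, k)`.

## References

* A. C. Cojocaru, M. R. Murty, *An Introduction to Sieve Methods and their Applications*, CUP 2005,
  §6.1 "Brun's pure sieve", (6.1)–(6.5) and Lemma 6.1.1.
* H. Halberstam, H.-E. Richert, *Sieve Methods* (1974), Ch. 2 §1.
-/

open Finset Real

namespace Literature.NumberTheory.Sieve

namespace BrunPureSieve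

variable {ι : Type*} [DecidableEq ι]

/-! ### The truncated alternating binomial sum -/

/-- `∑_{k ≤ r} (-1)^k C(m, k)`: equal to `1` for `m = 0` and to `(-1)^r C(m-1, r)` for `m ≥ 1`
(Cojocaru–Murty (6.1); Mathlib's `Int.alternating_sum_range_choose_eq_choose`).
[cite: CojocaruMurty2005, §6.1 (6.1)] -/
theorem alternatingSum_choose_eq (m r : ℕ) :
    ∑ k ∈ range (r + 1), (-1 : ℝ) ^ k * (m.choose k : ℝ) =
      if m = 0 then 1 else (-1 : ℝ) ^ r * ((m - 1).choose r : ℝ) := by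
  rcases Nat.eq_zero_or_pos m with rfl | hm
  · rw [if_pos rfl, Finset.sum_range_succ']
    simp
  · obtain ⟨n, rfl⟩ : ∃ n, m = n + 1 := ⟨m - 1, by omega⟩
    rw [if_neg (Nat.succ_ne_zero n), Nat.add_sub_cancel]
    have h := (Int.alternating_sum_range_choose_eq_choose (n := n) (m := r))
    have h' : ((∑ k ∈ range (r + 1), ((-1) ^ k * ((n + 1).choose k) : ℤ) : ℤ) : ℝ) =
        (((-1) ^ r * (n.choose r) : ℤ) : ℝ) := by rw [h]
    push_cast at h'
    exact h'

/-- For even `r`: `[m = 0] ≤ ∑_{k ≤ r} (-1)^k C(m, k)` (Cojocaru–Murty (6.3), `ψ_r(n) ≥ 0`).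
[cite: CojocaruMurty2005, §6.1 (6.3)] -/
theorem indicator_le_alternatingSum_choose {r : ℕ} (hr : Even r) (m : ℕ) :
    (if m = 0 then (1 : ℝ) else 0) ≤ ∑ k ∈ range (r + 1), (-1 : ℝ) ^ k * (m.choose k : ℝ) := by
  rw [alternatingSum_choose_eq]
  split_ifs
  · exact le_rfl
  · rw [hr.neg_one_pow, one_mul]
    positivity

/-- For even `r`: `∑_{k ≤ r} (-1)^k C(m, k) ≤ [m = 0] + C(m, r+1)` (since `C(m-1, r) ≤ C(m, r+1)`).
[cite: CojocaruMurty2005, §6.1 (6.4)] -/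
theorem alternatingSum_choose_le {r : ℕ} (hr : Even r) (m : ℕ) :
    ∑ k ∈ range (r + 1), (-1 : ℝ) ^ k * (m.choose k : ℝ) ≤
      (if m = 0 then (1 : ℝ) else 0) + (m.choose (r + 1) : ℝ) := by
  rw [alternatingSum_choose_eq]
  split_ifs with h
  · subst h; simp
  · rw [hr.neg_one_pow, one_mul, zero_add]
    obtain ⟨n, rfl⟩ : ∃ n, m = n + 1 := ⟨m - 1, by omega⟩
    rw [Nat.add_sub_cancel, Nat.choose_succ_succ]
    push_cast
    linarith [(Nat.cast_nonneg (n.choose (r + 1)) : (0 : ℝ) ≤ _)]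

/-! ### Abstract Bonferroni inequalities -/

/-- Rearrangement: `∑_{S ⊆ P, #S = k} ∑_{T ⊆ P, T ⊇ S} w(T) = ∑_{T ⊆ P} w(T) C(#T, k)`. [folklore] -/
theorem sum_powersetCard_sum_supersets (P : Finset ι) (w : Finset ι → ℝ) (k : ℕ) :
    ∑ S ∈ P.powersetCard k, ∑ T ∈ P.powerset with S ⊆ T, w T =
      ∑ T ∈ P.powerset, w T * ((#T).choose k : ℝ) := by
  simp_rw [Finset.sum_filter]
  rw [Finset.sum_comm]
  refine Finset.sum_congr rfl fun T hT => ?_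
  rw [Finset.mem_powerset] at hT
  rw [← Finset.sum_filter, Finset.sum_const, nsmul_eq_mul, mul_comm]
  congr 2
  rw [← Finset.card_powersetCard k T]
  congr 1
  ext S
  simp only [Finset.mem_filter, Finset.mem_powersetCard]
  exact ⟨fun h => ⟨h.2, h.1.2⟩, fun h => ⟨⟨h.1.trans hT, h.2⟩, h.1⟩⟩

/-- The Bonferroni sum expressed through the weights:
`∑_{k ≤ r} (-1)^k ∑_{#S = k} F(S) = ∑_T w(T) ∑_{k ≤ r} (-1)^k C(#T, k)`. [folklore] -/
theorem bonferroniSum_eq (P : Finset ι) (w : Finset ι → ℝ) (r : ℕ) :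
    ∑ k ∈ range (r + 1), (-1 : ℝ) ^ k *
        ∑ S ∈ P.powersetCard k, ∑ T ∈ P.powerset with S ⊆ T, w T =
      ∑ T ∈ P.powerset, w T * ∑ k ∈ range (r + 1), (-1 : ℝ) ^ k * ((#T).choose k : ℝ) := by
  simp_rw [sum_powersetCard_sum_supersets, Finset.mul_sum]
  rw [Finset.sum_comm]
  refine Finset.sum_congr rfl fun T _ => Finset.sum_congr rfl fun k _ => by ring

/-- **Bonferroni's inequality, lower form** (even truncation over-counts): for nonnegative weights
`w` on the subsets of `P` and even `r`,
`w(∅) ≤ ∑_{k ≤ r} (-1)^k ∑_{S ⊆ P, #S = k} ∑_{T ⊇ S} w(T)`. [folklore] -/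
theorem bonferroni_lower (P : Finset ι) (w : Finset ι → ℝ) (hw : ∀ T ∈ P.powerset, 0 ≤ w T)
    {r : ℕ} (hr : Even r) :
    w ∅ ≤ ∑ k ∈ range (r + 1), (-1 : ℝ) ^ k *
        ∑ S ∈ P.powersetCard k, ∑ T ∈ P.powerset with S ⊆ T, w T := by
  rw [bonferroniSum_eq]
  calc w ∅ = ∑ T ∈ P.powerset, w T * (if #T = 0 then (1 : ℝ) else 0) := by
        simp only [Finset.card_eq_zero, mul_ite, mul_one, mul_zero, Finset.sum_ite_eq',
          Finset.empty_mem_powerset, if_true]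
    _ ≤ _ := Finset.sum_le_sum fun T hT =>
        mul_le_mul_of_nonneg_left (indicator_le_alternatingSum_choose hr _) (hw T hT)

/-- **Bonferroni's inequality, upper form**: for nonnegative weights `w` on the subsets of `P` and
even `r`, `∑_{k ≤ r} (-1)^k ∑_{#S = k} ∑_{T ⊇ S} w(T) ≤ w(∅) + ∑_{#S = r+1} ∑_{T ⊇ S} w(T)`
(Cojocaru–Murty Lemma 6.1.1 in the weighted form). [cite: CojocaruMurty2005, §6.1 Lemma 6.1.1] -/
theorem bonferroni_upper (P : Finset ι) (w : Finset ι → ℝ) (hw : ∀ T ∈ P.powerset, 0 ≤ w T)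
    {r : ℕ} (hr : Even r) :
    ∑ k ∈ range (r + 1), (-1 : ℝ) ^ k *
        ∑ S ∈ P.powersetCard k, ∑ T ∈ P.powerset with S ⊆ T, w T ≤
      w ∅ + ∑ S ∈ P.powersetCard (r + 1), ∑ T ∈ P.powerset with S ⊆ T, w T := by
  rw [bonferroniSum_eq, sum_powersetCard_sum_supersets]
  calc ∑ T ∈ P.powerset, w T * ∑ k ∈ range (r + 1), (-1 : ℝ) ^ k * ((#T).choose k : ℝ)
      ≤ ∑ T ∈ P.powerset, w T * ((if #T = 0 then (1 : ℝ) else 0) + ((#T).choose (r + 1) : ℝ)) :=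
        Finset.sum_le_sum fun T hT =>
          mul_le_mul_of_nonneg_left (alternatingSum_choose_le hr _) (hw T hT)
    _ = ∑ T ∈ P.powerset, w T * (if #T = 0 then (1 : ℝ) else 0)
          + ∑ T ∈ P.powerset, w T * ((#T).choose (r + 1) : ℝ) := by
        rw [← Finset.sum_add_distrib]
        exact Finset.sum_congr rfl fun T _ => by ring
    _ = w ∅ + ∑ T ∈ P.powerset, w T * ((#T).choose (r + 1) : ℝ) := by
        congr 1
        simp only [Finset.card_eq_zero, mul_ite, mul_one, mul_zero, Finset.sum_ite_eq',
          Finset.empty_mem_powerset, if_true]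

/-! ### Independent events: the sifting density -/

/-- Marginals of the product measure: for `S ⊆ P`,
`∑_{S ⊆ T ⊆ P} ∏_{p ∈ T} ν(p) ∏_{p ∈ P ∖ T} (1 - ν(p)) = ∏_{p ∈ S} ν(p)`. [folklore] -/
theorem sum_supersets_prod_mul_prod_one_sub (P : Finset ι) (ν : ι → ℝ) {S : Finset ι}
    (hS : S ⊆ P) :
    ∑ T ∈ P.powerset with S ⊆ T, (∏ p ∈ T, ν p) * ∏ p ∈ P \ T, (1 - ν p) = ∏ p ∈ S, ν p := by
  -- reindex `T = S ∪ U`, `U ⊆ P \ S`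
  have hbij : ∑ T ∈ P.powerset with S ⊆ T, (∏ p ∈ T, ν p) * ∏ p ∈ P \ T, (1 - ν p) =
      ∑ U ∈ (P \ S).powerset, (∏ p ∈ S ∪ U, ν p) * ∏ p ∈ P \ (S ∪ U), (1 - ν p) := by
    refine Finset.sum_nbij' (fun T => T \ S) (fun U => S ∪ U) ?_ ?_ ?_ ?_ ?_
    · intro T hT
      simp only [Finset.mem_filter, Finset.mem_powerset] at hT ⊢
      exact Finset.sdiff_subset_sdiff hT.1 subset_rfl
    · intro U hU
      simp only [Finset.mem_filter, Finset.mem_powerset] at hU ⊢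
      refine ⟨Finset.union_subset hS (hU.trans Finset.sdiff_subset), Finset.subset_union_left⟩
    · intro T hT
      simp only [Finset.mem_filter, Finset.mem_powerset] at hT
      exact Finset.union_sdiff_of_subset hT.2
    · intro U hU
      simp only [Finset.mem_powerset] at hU
      rw [Finset.union_sdiff_left, Finset.sdiff_eq_self_of_disjoint]
      exact (Finset.disjoint_sdiff.mono_right hU).symm
    · intro T hT
      simp only [Finset.mem_filter, Finset.mem_powerset] at hT
      rw [Finset.union_sdiff_of_subset hT.2]
  rw [hbij]
  have hsplit : ∀ U ∈ (P \ S).powerset,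
      (∏ p ∈ S ∪ U, ν p) * ∏ p ∈ P \ (S ∪ U), (1 - ν p) =
        (∏ p ∈ S, ν p) * ((∏ p ∈ U, ν p) * ∏ p ∈ (P \ S) \ U, (1 - ν p)) := by
    intro U hU
    rw [Finset.mem_powerset] at hU
    have hdisj : Disjoint S U := Finset.disjoint_sdiff.mono_right hU
    rw [Finset.prod_union hdisj, Finset.sdiff_union_distrib, mul_assoc]
    congr 2
    rw [Finset.sdiff_sdiff_left']
  rw [Finset.sum_congr rfl hsplit, ← Finset.mul_sum, ← Finset.prod_add]
  have h1 : ∏ p ∈ P \ S, (ν p + (1 - ν p)) = 1 := Finset.prod_eq_one fun p _ => by ring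
  rw [h1, mul_one]

/-- The product measure has nonnegative weights when `0 ≤ ν ≤ 1` on `P`. [folklore] -/
theorem prod_mul_prod_one_sub_nonneg (P : Finset ι) (ν : ι → ℝ) (h0 : ∀ p ∈ P, 0 ≤ ν p)
    (h1 : ∀ p ∈ P, ν p ≤ 1) {T : Finset ι} (hT : T ∈ P.powerset) :
    0 ≤ (∏ p ∈ T, ν p) * ∏ p ∈ P \ T, (1 - ν p) := by
  rw [Finset.mem_powerset] at hT
  refine mul_nonneg (Finset.prod_nonneg fun p hp => h0 p (hT hp))
    (Finset.prod_nonneg fun p hp => sub_nonneg.mpr (h1 p (Finset.sdiff_subset hp)))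

/-- **Truncated inclusion–exclusion for a product** (Bonferroni, lower form): for `0 ≤ ν(p) ≤ 1` on
`P` and even `r`, `∏_{p ∈ P} (1 - ν(p)) ≤ ∑_{k ≤ r} (-1)^k ∑_{S ⊆ P, #S = k} ∏_{p ∈ S} ν(p)`. [folklore] -/
theorem prod_one_sub_le_bonferroniSum (P : Finset ι) (ν : ι → ℝ) (h0 : ∀ p ∈ P, 0 ≤ ν p)
    (h1 : ∀ p ∈ P, ν p ≤ 1) {r : ℕ} (hr : Even r) :
    ∏ p ∈ P, (1 - ν p) ≤
      ∑ k ∈ range (r + 1), (-1 : ℝ) ^ k * ∑ S ∈ P.powersetCard k, ∏ p ∈ S, ν p := by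
  set w : Finset ι → ℝ := fun T => (∏ p ∈ T, ν p) * ∏ p ∈ P \ T, (1 - ν p) with hw
  have h := bonferroni_lower P w (fun T hT => prod_mul_prod_one_sub_nonneg P ν h0 h1 hT) hr
  have hw0 : w ∅ = ∏ p ∈ P, (1 - ν p) := by simp [hw]
  rw [hw0] at h
  refine h.trans (le_of_eq (Finset.sum_congr rfl fun k _ => ?_))
  congr 1
  refine Finset.sum_congr rfl fun S hS => ?_
  exact sum_supersets_prod_mul_prod_one_sub P ν (Finset.mem_powersetCard.mp hS).1

/-- **Truncated inclusion–exclusion for a product** (Bonferroni, upper form): for `0 ≤ ν(p) ≤ 1` on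
`P` and even `r`,
`∑_{k ≤ r} (-1)^k ∑_{#S = k} ∏_{p ∈ S} ν(p) ≤ ∏_{p ∈ P} (1 - ν(p)) + ∑_{#S = r+1} ∏_{p ∈ S} ν(p)`.
[folklore] -/
theorem bonferroniSum_le_prod_one_sub_add (P : Finset ι) (ν : ι → ℝ) (h0 : ∀ p ∈ P, 0 ≤ ν p)
    (h1 : ∀ p ∈ P, ν p ≤ 1) {r : ℕ} (hr : Even r) :
    ∑ k ∈ range (r + 1), (-1 : ℝ) ^ k * ∑ S ∈ P.powersetCard k, ∏ p ∈ S, ν p ≤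
      ∏ p ∈ P, (1 - ν p) + ∑ S ∈ P.powersetCard (r + 1), ∏ p ∈ S, ν p := by
  set w : Finset ι → ℝ := fun T => (∏ p ∈ T, ν p) * ∏ p ∈ P \ T, (1 - ν p) with hw
  have h := bonferroni_upper P w (fun T hT => prod_mul_prod_one_sub_nonneg P ν h0 h1 hT) hr
  have hw0 : w ∅ = ∏ p ∈ P, (1 - ν p) := by simp [hw]
  have hF : ∀ k, ∀ S ∈ P.powersetCard k, ∑ T ∈ P.powerset with S ⊆ T, w T = ∏ p ∈ S, ν p :=
    fun k S hS => sum_supersets_prod_mul_prod_one_sub P ν (Finset.mem_powersetCard.mp hS).1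
  rw [hw0, Finset.sum_congr rfl (hF (r + 1))] at h
  refine le_trans (le_of_eq (Finset.sum_congr rfl fun k _ => ?_)) h
  rw [Finset.sum_congr rfl (hF k)]

/-! ### Counting: Brun's pure sieve inequality -/

/-- **Brun's pure sieve inequality** (Cojocaru–Murty (6.5), first line: `Φ ≤ ∑_n ∑_{d ∣ (n, P)} μ_r(d)`
for even `r`): for a finite set `A`, a finite index set `P` of "events" `E_p = {n : R p n}` and even
`r`, `#{n ∈ A : ¬ R p n ∀ p ∈ P} ≤ ∑_{k ≤ r} (-1)^k ∑_{S ⊆ P, #S = k} #{n ∈ A : R p n ∀ p ∈ S}`.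
[cite: CojocaruMurty2005, §6.1 (6.5)] -/
theorem card_filter_forall_not_le_bonferroniSum {α : Type*} (A : Finset α) (P : Finset ι)
    (R : ι → α → Prop) [∀ p n, Decidable (R p n)] {r : ℕ} (hr : Even r) :
    (#{n ∈ A | ∀ p ∈ P, ¬ R p n} : ℝ) ≤
      ∑ k ∈ range (r + 1), (-1 : ℝ) ^ k *
        ∑ S ∈ P.powersetCard k, (#{n ∈ A | ∀ p ∈ S, R p n} : ℝ) := by
  classical
  -- weights: `w T = #{n ∈ A : {p ∈ P : R p n} = T}`
  set ev : α → Finset ι := fun n => P.filter (fun p => R p n) with hev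
  set w : Finset ι → ℝ := fun T => (#{n ∈ A | ev n = T} : ℝ) with hw
  have h := bonferroni_lower P w (fun T _ => by positivity) hr
  have hw0 : w ∅ = (#{n ∈ A | ∀ p ∈ P, ¬ R p n} : ℝ) := by
    simp only [hw, hev]
    congr 2
    ext n
    simp only [Finset.mem_filter, and_congr_right_iff]
    intro _
    rw [Finset.filter_eq_empty_iff]
  have hF : ∀ S ⊆ P, ∑ T ∈ P.powerset with S ⊆ T, w T = (#{n ∈ A | ∀ p ∈ S, R p n} : ℝ) := by
    intro S hS
    simp only [hw]
    rw [← Nat.cast_sum, Nat.cast_inj]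
    rw [Finset.card_eq_sum_card_fiberwise (f := ev) (t := P.powerset.filter (fun T => S ⊆ T))]
    · refine Finset.sum_congr rfl fun T hT => ?_
      rw [Finset.filter_filter]
      have hST : S ⊆ T := (Finset.mem_filter.mp hT).2
      have hcong : ∀ n ∈ A, ((∀ p ∈ S, R p n) ∧ ev n = T) ↔ ev n = T := by
        intro n _
        refine ⟨fun h => h.2, fun h2 => ⟨fun p hp => ?_, h2⟩⟩
        have hp' : p ∈ ev n := h2 ▸ hST hp
        exact (Finset.mem_filter.mp hp').2
      rw [Finset.filter_congr hcong]
    · intro n hn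
      simp only [Finset.coe_filter, Set.mem_setOf_eq, Finset.mem_powerset]
      rw [Finset.mem_coe, Finset.mem_filter] at hn
      exact ⟨Finset.filter_subset _ _, fun p hp => Finset.mem_filter.mpr ⟨hS hp, hn.2 p hp⟩⟩
  rw [hw0] at h
  refine h.trans (le_of_eq (Finset.sum_congr rfl fun k _ => ?_))
  congr 1
  exact Finset.sum_congr rfl fun S hS => hF S (Finset.mem_powersetCard.mp hS).1

/-! ### Rankin's bound for elementary symmetric functions -/

omit [DecidableEq ι] in
/-- **Rankin's trick** for the elementary symmetric functions of nonnegative reals: for `λ > 0`,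
`e_k(ν) = ∑_{S ⊆ P, #S = k} ∏_{p ∈ S} ν(p) ≤ λ^{-k} ∏_{p ∈ P} (1 + λ ν(p)) ≤ λ^{-k} exp(λ ∑_p ν(p))`.
[folklore] -/
theorem esymm_le_inv_pow_mul_exp (P : Finset ι) (ν : ι → ℝ) (h0 : ∀ p ∈ P, 0 ≤ ν p) (k : ℕ)
    {lam : ℝ} (hlam : 0 < lam) :
    ∑ S ∈ P.powersetCard k, ∏ p ∈ S, ν p ≤
      (lam ^ k)⁻¹ * Real.exp (lam * ∑ p ∈ P, ν p) := by
  have hkey : lam ^ k * ∑ S ∈ P.powersetCard k, ∏ p ∈ S, ν p ≤ ∏ p ∈ P, (1 + lam * ν p) := by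
    rw [Finset.prod_one_add, Finset.mul_sum]
    calc ∑ S ∈ P.powersetCard k, lam ^ k * ∏ p ∈ S, ν p
        = ∑ S ∈ P.powersetCard k, ∏ p ∈ S, lam * ν p := by
          refine Finset.sum_congr rfl fun S hS => ?_
          rw [Finset.prod_mul_distrib, Finset.prod_const, (Finset.mem_powersetCard.mp hS).2]
      _ ≤ ∑ S ∈ P.powerset, ∏ p ∈ S, lam * ν p := by
          refine Finset.sum_le_sum_of_subset_of_nonneg
            (fun S hS => Finset.mem_powerset.mpr (Finset.mem_powersetCard.mp hS).1)
            fun S hS _ => Finset.prod_nonneg fun p hp => ?_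
          exact mul_nonneg hlam.le (h0 p (Finset.mem_powerset.mp hS hp))
  have hexp : ∏ p ∈ P, (1 + lam * ν p) ≤ Real.exp (lam * ∑ p ∈ P, ν p) := by
    rw [Finset.mul_sum]
    refine (Finset.prod_le_prod (fun p hp => by nlinarith [h0 p hp]) fun p hp => ?_).trans
      (le_of_eq (Real.exp_sum P _).symm)
    linarith [Real.add_one_le_exp (lam * ν p)]
  rw [le_inv_mul_iff₀ (pow_pos hlam k)]
  exact hkey.trans hexp

/-! ### The pure sieve for an interval of integers -/

/-- Multiples of `d` in `[a, b]` (`1 ≤ a ≤ b + 1`): `#{n ∈ [a, b] : d ∣ n} = ⌊b/d⌋ - ⌊(a-1)/d⌋`. [folklore] -/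
theorem card_Icc_filter_dvd {a b : ℕ} (ha : 1 ≤ a) (hab : a ≤ b + 1) (d : ℕ) :
    #{n ∈ Icc a b | d ∣ n} = b / d - (a - 1) / d := by
  have h1 : (Icc a b).filter (fun n => d ∣ n) =
      (Ioc 0 b).filter (fun n => d ∣ n) \ (Ioc 0 (a - 1)).filter (fun n => d ∣ n) := by
    ext n
    simp only [Finset.mem_filter, Finset.mem_Icc, Finset.mem_sdiff, Finset.mem_Ioc]
    constructor
    · rintro ⟨⟨h1, h2⟩, h3⟩
      exact ⟨⟨⟨by omega, h2⟩, h3⟩, fun h => absurd h.1.2 (by omega)⟩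
    · rintro ⟨⟨⟨h1, h2⟩, h3⟩, h4⟩
      refine ⟨⟨?_, h2⟩, h3⟩
      by_contra h
      exact h4 ⟨⟨h1, by omega⟩, h3⟩
  rw [h1, Finset.card_sdiff_of_subset, Nat.Ioc_filter_dvd_card_eq_div,
    Nat.Ioc_filter_dvd_card_eq_div]
  intro n
  simp only [Finset.mem_filter, Finset.mem_Ioc, and_imp]
  intro h1 h2 h3
  exact ⟨⟨h1, by omega⟩, h3⟩

/-- The count of multiples of `d ≥ 1` in `[a, b]` (`1 ≤ a ≤ b + 1`) is `(b + 1 - a)/d + θ` with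
`|θ| ≤ 1`. [folklore] -/
theorem abs_card_Icc_filter_dvd_sub_le {a b : ℕ} (ha : 1 ≤ a) (hab : a ≤ b + 1) {d : ℕ}
    (hd : 1 ≤ d) :
    |(#{n ∈ Icc a b | d ∣ n} : ℝ) - ((b : ℝ) + 1 - a) / d| ≤ 1 := by
  rw [card_Icc_filter_dvd ha hab]
  have hd0 : (0 : ℝ) < d := by exact_mod_cast hd
  have e1 := Nat.div_add_mod b d
  have e2 := Nat.div_add_mod (a - 1) d
  have m1 := Nat.mod_lt b hd
  have m2 := Nat.mod_lt (a - 1) hd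
  have hdiv : (a - 1) / d ≤ b / d := Nat.div_le_div_right (by omega)
  rw [Nat.cast_sub hdiv]
  have q1 : ((b / d : ℕ) : ℝ) * d = b - (b % d : ℕ) := by
    have : ((d * (b / d) + b % d : ℕ) : ℝ) = b := by rw [e1]
    push_cast at this; linarith
  have q2 : (((a - 1) / d : ℕ) : ℝ) * d = (a : ℝ) - 1 - ((a - 1) % d : ℕ) := by
    have : ((d * ((a - 1) / d) + (a - 1) % d : ℕ) : ℝ) = (a - 1 : ℕ) := by rw [e2]
    rw [Nat.cast_sub ha] at this
    push_cast at this; linarith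
  have r1 : ((b % d : ℕ) : ℝ) < d := by exact_mod_cast m1
  have r2 : (((a - 1) % d : ℕ) : ℝ) < d := by exact_mod_cast m2
  have r1' : (0 : ℝ) ≤ (b % d : ℕ) := Nat.cast_nonneg _
  have r2' : (0 : ℝ) ≤ ((a - 1) % d : ℕ) := Nat.cast_nonneg _
  have key : ((b / d : ℕ) : ℝ) - (((a - 1) / d : ℕ) : ℝ) - ((b : ℝ) + 1 - a) / d =
      ((((a - 1) % d : ℕ) : ℝ) - ((b % d : ℕ) : ℝ)) / d := by
    field_simp
    linarith
  rw [key, abs_div, abs_of_pos hd0, div_le_one hd0]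
  exact (abs_sub_lt_iff.mpr ⟨by linarith, by linarith⟩).le

/-- For a set `S` of primes, `(∀ p ∈ S, p ∣ n) ↔ ∏_{p ∈ S} p ∣ n`. [folklore] -/
theorem forall_prime_dvd_iff_prod_dvd {S : Finset ℕ} (hS : ∀ p ∈ S, p.Prime) (n : ℕ) :
    (∀ p ∈ S, p ∣ n) ↔ (∏ p ∈ S, p) ∣ n :=
  ⟨fun h => Finset.prod_primes_dvd n (fun p hp => (hS p hp).prime) h,
    fun h _ hp => (Finset.dvd_prod_of_mem _ hp).trans h⟩

/-- `∑_{k ≤ r} C(m, k) ≤ (m + 1)^r`. [folklore] -/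
theorem sum_range_choose_le_pow (m r : ℕ) :
    ∑ k ∈ range (r + 1), (m.choose k : ℝ) ≤ ((m : ℝ) + 1) ^ r := by
  have h1 : ∀ k ∈ range (r + 1), (m.choose k : ℝ) ≤ (m : ℝ) ^ k * (r.choose k : ℝ) := by
    intro k hk
    have hk' : k ≤ r := Nat.lt_succ_iff.mp (Finset.mem_range.mp hk)
    have h2 : (m.choose k : ℝ) ≤ (m : ℝ) ^ k := by
      have := Nat.choose_le_pow_div k m (α := ℝ)
      refine this.trans (div_le_self (by positivity) ?_)
      exact_mod_cast Nat.one_le_iff_ne_zero.mpr (Nat.factorial_ne_zero k)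
    have h3 : (1 : ℝ) ≤ (r.choose k : ℝ) := by
      exact_mod_cast Nat.one_le_iff_ne_zero.mpr ((Nat.choose_ne_zero_iff).mpr hk')
    nlinarith [pow_nonneg (Nat.cast_nonneg m : (0 : ℝ) ≤ m) k]
  refine (Finset.sum_le_sum h1).trans (le_of_eq ?_)
  rw [add_pow]
  refine Finset.sum_congr rfl fun k _ => by simp [one_pow]

/-- **Brun's pure sieve for an interval** (Cojocaru–Murty §6.1, (6.5) with the main term treated by
the Bonferroni inequalities): for a finite set `P` of primes, `1 ≤ a ≤ b + 1` and even `r`,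
`#{n ∈ [a, b] : p ∤ n for all p ∈ P}
  ≤ (b + 1 - a) (∏_{p ∈ P} (1 - 1/p) + ∑_{S ⊆ P, #S = r+1} ∏_{p ∈ S} 1/p) + ∑_{k ≤ r} C(#P, k)`.
The last two terms are bounded by `esymm_le_inv_pow_mul_exp` and `sum_range_choose_le_pow`.
[cite: CojocaruMurty2005, §6.1 (6.5)] -/
theorem brun_pure_sieve_Icc (P : Finset ℕ) (hP : ∀ p ∈ P, p.Prime) {a b : ℕ} (ha : 1 ≤ a)
    (hab : a ≤ b + 1) {r : ℕ} (hr : Even r) :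
    (#{n ∈ Icc a b | ∀ p ∈ P, ¬ p ∣ n} : ℝ) ≤
      ((b : ℝ) + 1 - a) *
          (∏ p ∈ P, (1 - (p : ℝ)⁻¹) + ∑ S ∈ P.powersetCard (r + 1), ∏ p ∈ S, (p : ℝ)⁻¹)
        + ∑ k ∈ range (r + 1), ((#P).choose k : ℝ) := by
  classical
  set L : ℝ := (b : ℝ) + 1 - a with hL
  have hL0 : 0 ≤ L := by
    have : (a : ℝ) ≤ (b : ℝ) + 1 := by exact_mod_cast hab
    simp only [hL]; linarith
  -- Step 1: counting Bonferroni
  have step1 := card_filter_forall_not_le_bonferroniSum (Icc a b) P (fun p n => p ∣ n) hr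
  -- Step 2: each term `(-1)^k #{n : S | n} ≤ (-1)^k L ∏ p⁻¹ + 1`
  have step2 : ∀ k ∈ range (r + 1), ∀ S ∈ P.powersetCard k,
      (-1 : ℝ) ^ k * (#{n ∈ Icc a b | ∀ p ∈ S, p ∣ n} : ℝ) ≤
        (-1 : ℝ) ^ k * (L * ∏ p ∈ S, (p : ℝ)⁻¹) + 1 := by
    intro k _ S hS
    have hSP : S ⊆ P := (Finset.mem_powersetCard.mp hS).1
    have hSprime : ∀ p ∈ S, p.Prime := fun p hp => hP p (hSP hp)
    have hfilter : (Icc a b).filter (fun n => ∀ p ∈ S, p ∣ n) =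
        (Icc a b).filter (fun n => (∏ p ∈ S, p) ∣ n) :=
      Finset.filter_congr fun n _ => forall_prime_dvd_iff_prod_dvd hSprime n
    have hd : 1 ≤ ∏ p ∈ S, p :=
      Nat.one_le_iff_ne_zero.mpr (Finset.prod_ne_zero_iff.mpr fun p hp => (hSprime p hp).ne_zero)
    have habs := abs_card_Icc_filter_dvd_sub_le ha hab hd
    rw [← hfilter] at habs
    have hprod : (L * ∏ p ∈ S, (p : ℝ)⁻¹) = L / ((∏ p ∈ S, p : ℕ) : ℝ) := by
      rw [Nat.cast_prod, div_eq_mul_inv, Finset.prod_inv_distrib]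
    rw [hprod]
    rw [abs_le] at habs
    rcases neg_one_pow_eq_or ℝ k with h1 | h1 <;> rw [h1] <;> linarith
  -- Step 3: sum up
  have step3 : ∑ k ∈ range (r + 1), (-1 : ℝ) ^ k *
      ∑ S ∈ P.powersetCard k, (#{n ∈ Icc a b | ∀ p ∈ S, p ∣ n} : ℝ) ≤
      L * ∑ k ∈ range (r + 1), (-1 : ℝ) ^ k * ∑ S ∈ P.powersetCard k, ∏ p ∈ S, (p : ℝ)⁻¹
        + ∑ k ∈ range (r + 1), ((#P).choose k : ℝ) := by
    calc ∑ k ∈ range (r + 1), (-1 : ℝ) ^ k *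
          ∑ S ∈ P.powersetCard k, (#{n ∈ Icc a b | ∀ p ∈ S, p ∣ n} : ℝ)
        = ∑ k ∈ range (r + 1), ∑ S ∈ P.powersetCard k,
            (-1 : ℝ) ^ k * (#{n ∈ Icc a b | ∀ p ∈ S, p ∣ n} : ℝ) := by
          simp_rw [Finset.mul_sum]
      _ ≤ ∑ k ∈ range (r + 1), ∑ S ∈ P.powersetCard k,
            ((-1 : ℝ) ^ k * (L * ∏ p ∈ S, (p : ℝ)⁻¹) + 1) :=
          Finset.sum_le_sum fun k hk => Finset.sum_le_sum fun S hS => step2 k hk S hS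
      _ = _ := by
          simp_rw [Finset.sum_add_distrib, Finset.sum_const, nsmul_eq_mul, mul_one,
            Finset.card_powersetCard, Finset.mul_sum]
          congr 1
          refine Finset.sum_congr rfl fun k _ => Finset.sum_congr rfl fun S _ => by ring
  -- Step 4: Bonferroni for the product
  have step4 := bonferroniSum_le_prod_one_sub_add P (fun p => (p : ℝ)⁻¹)
    (fun p _ => by positivity) (fun p hp => inv_le_one_of_one_le₀ (by exact_mod_cast (hP p hp).one_lt.le)) hr
  calc (#{n ∈ Icc a b | ∀ p ∈ P, ¬ p ∣ n} : ℝ) ≤ _ := step1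
    _ ≤ _ := step3
    _ ≤ _ := by gcongr


end BrunPureSieve

end Literature.NumberTheory.Sieve
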